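import Literature.Barriers.CriticalPhenomena.PositionSpaceRGNonGibbsianUnfixing
import Literature.Probability.LatticeModels.IsingUnfixing
import HarnessLib

/-!
# Barrier `PositionSpaceRGNonGibbsian` (van Enter–Fernández–Sokal 1993, Theorem 4.2), layer 4:
# the uniform gap (4.12) from phase selection (Steps 2.1–2.3) and the magnetisation of the
# internal `+` phase (Steps 1, 2.4) — the expansion (4.12) with Griffiths' first inequality, proved

Companion file of `Literature/Barriers/CriticalPhenomena/PositionSpaceRGNonGibbsian.lean`, on the
line of Theorem 4.2 (`NonGibbs.VEFS1993_thm42`, the barrier statement; `b = 2`, `d ≥ 3`,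
`β > β_c(d-1)`). The chain so far, all proved: `VEFS1993_eq412 → VEFS1993_eq413 → VEFS1993_eq432
→ VEFS1993_thm42` (`PositionSpaceRGNonGibbsianUnfixing.lean`: Step 3, the unfixing of the origin,
eqs. (4.7)–(4.9), and the FKG reduction to the extremal boundary conditions;
`…FiniteVolume.lean`; `…Proofs.lean`). The open named fact `VEFS1993_eq412` is the uniform lower
bound `y - x ≥ η > 0` on the two expectations of (4.10)–(4.11) in the internal-spin system with the
origin fixed. Here `VEFS1993_eq412` is derived — proving the printed (4.12), "`y - x =
2⟨sinh 2J(…)⟩₊ ≥ 16J⟨σ_{0,1}⟩₊` since the contributions from `k = 3, 5, …` are all nonnegative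
by Griffiths' first inequality" — from the two statements the printed Step 2 establishes for
that internal-spin system: phase selection by the image spins of the annulus, in FKG sense
(Steps 2.1–2.3; vendored as the named fact `VEFS1993_step2`, for the two extremal boundary
conditions appearing in `VEFS1993_eq412`), and strictly positive magnetisation of the `+` phase of
the periodically diluted internal-spin system at the neighbours of the origin (Step 1 with
Step 2.4, "`⟨σ_{0,1}⟩₊` is bounded below by a strictly positive constant, uniformly in `R`";
vendored as `VEFS1993_step24`). The expansion of `e^{±2JS}` into spin products and the GKS bound
are the general lemmas `exp_mul_spinTotal_eq_sum`, `isingExpect_exp_spinTotal_sub_ge` of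
`Literature/Probability/LatticeModels/IsingUnfixing.lean`; they are applied in the `+` state of
the decorated lattice of internal spins, where the first Griffiths inequality holds (not in the
annulus systems with their arbitrary exterior). Nothing is asserted (D-0014): `VEFS1993_step2`
and `VEFS1993_step24` are `def … : Prop`; `VEFS1993_eq412_of_step2` is proved.

## What the source prints (arXiv:hep-lat/9210032; section/equation numbers of the paper)

* §4.1.2 Step 1 (p. 94): "each internal spin is adjacent either to two image spins of opposite
  sign — in which case the effective magnetic fields cancel — or else to no image spin. Therefore,
  the modified object system is simply a ferromagnetic Ising model in zero field on a decorated
  lattice, as shown in Figure 3(b)" (Figure 3 (b): "The decorated system of internal spins").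
* §4.1.2 Step 3 (p. 100): "`y - x = 2⟨sinh 2J(σ_{0,1}+σ_{0,-1}+σ_{1,0}+σ_{-1,0})⟩₊ =
  2 ∑_{k odd} (2J)^k/k! ⟨(…)^k⟩₊ ≥ 4J⟨(…)⟩₊ = 16J⟨σ_{0,1}⟩₊` (4.12) since the contributions from
  `k = 3, 5, …` are all nonnegative by Griffiths' first inequality. … Since we proved previously
  that for `J' > J_c`, the local magnetization `⟨σ_{0,1}⟩₊` is bounded below by a strictly
  positive constant, uniformly in `R` (sufficiently large) and in the configuration outside
  `Λ_{R+2}`, we can conclude that `⟨σ_{0,0}⟩^§₊ - ⟨σ_{0,0}⟩^§₋ ≥ δ > 0` (4.13)"; footnote 48: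
  "Because we have fixed the image spin at the origin to be `+`, the two situations are not quite
  symmetric. But the only change is a shift in the location of the internal spins in `∂_{R+1}`
  which feel a nonzero effective field; and this is irrelevant, since we replace these fields by
  zero anyway."
* §4.3.1 Step 1 (p. 107): "the diluted system is a collection of `(d-1)`-dimensional diluted and
  undiluted Ising models, ferromagnetically coupled. In particular, the `d`-dimensional diluted
  system is more ferromagnetic than the `(d-1)`-dimensional undiluted Ising model, and hence
  exhibits spontaneous magnetization for all temperatures below the critical temperature
  `J_{c,d-1}` of the `(d-1)`-dimensional undiluted Ising model."
* §4.3.1 Step 2 (pp. 108–109): the systems `⟨R,R';Σ,+,σ⟩` ("the system of internal spins in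
  volume `Λ^int_{R'}`, with the image spins in `Λ^image_R` fixed in the alternating (`Σ`)
  configuration, the image spins in the annulus `Λ^image_{R'} ∖ Λ^image_R` fixed to be all `+`,
  and the spins outside `Λ_{R'}` (both image and internal) fixed in an arbitrary configuration
  `σ`"), `⟨R;∞;Σ;+⟩` and `⟨∞;Σ⟩` ("the image spins everywhere fixed in the alternating (`Σ`)
  configuration"; "precisely the Ising model on a periodically diluted lattice", p. 111); "We
  shall prove the following: Step 2.1) `μ^{Σ,+,σ}_{R,R'}` converges as `R' → ∞` to a Gibbs measure
  for the system `⟨R;∞;Σ;+⟩`. Step 2.2) The system `⟨R;∞;Σ;+⟩` has a unique Gibbs measure, call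
  it `μ^{Σ,+}_{R,∞}`. Step 2.3) The measure `μ^{Σ,+}_{R,∞}` is larger (in FKG sense) than all
  Gibbs measures for the system `⟨∞;Σ⟩`. Step 2.4) Let `μ^{∞(+)}_Σ` be the `+` phase (i.e. the
  maximal Gibbs measure in FKG sense) for the system `⟨∞;Σ⟩`. Then `μ^{∞(+)}_Σ(σ_i) ≥ c > 0`.
  From these results we will then deduce (4.26)."; (4.26)–(4.27): "`⟨σ_i⟩^{R,R'}_{Σ,+,σ} ≥
  ⟨σ_i⟩^{R,R'}_{Σ,+,-} ≥ c > 0` and by symmetry `⟨σ_i⟩^{R,R'}_{Σ,-,σ} ≤ ⟨σ_i⟩^{R,R'}_{Σ,-,+} ≤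
  -c < 0` for every configuration `σ` outside `Λ_{R'}` and every `i ∈ Λ^int_R`"; footnote 51:
  "We say that `μ ≤ ν` in FKG sense in case `μ(f) ≤ ν(f)` for all increasing local observables
  `f`." Step 2.2 (p. 110): "(We only need uniqueness at low enough temperature, but in fact the
  Gibbs measure is unique at all temperatures.)"
* §4.2 Step 1 (p. 104): "(For the decimation example, `f` is the spin at a neighbor of the
  origin.)"

## What is formalised (namespace `Literature.Barriers.CriticalPhenomena.NonGibbs`)

* Definition: `decoratedGraph d` (the decorated lattice of internal spins, Figure 3 (b): the
  nearest-neighbour graph of `ℤ^d` restricted to the internal sites — those off `2ℤ^d`, the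
  complement of the filter defining `gpiVolume'`; every image site, the origin included, is
  isolated).
* Named facts (not proved): `VEFS1993_step24` (Steps 1 and 2.4: `⟨σ_y⟩⁺ ≥ c > 0` for the
  neighbours `y` of the origin in the finite-volume `+` states of the decorated lattice, uniformly
  in the volume `Λ^int_L = gpiVolume' d L`) and `VEFS1993_step2` (Steps 2.1–2.3 in finite volume:
  for every increasing local observable of the internal spins, each of the two internal-spin
  systems of `VEFS1993_eq412` — extremal boundary conditions `coreAnnulusBC d 2 R R' 1 (-1)` and
  `-coreAnnulusBC d 2 R R' (-1) 1` — dominates the decorated `+` state up to `ε`, for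
  `R', L ≥ N(f, R, ε)`).
* Proved: the lattice geometry (`zdGraph_adj_zero_iff`, `not_forall_two_dvd_of_adj_zero`,
  `nbrSpinSum_eq_spinTotal`), and (4.12):
  `VEFS1993_eq412_of_step2 : VEFS1993_step2 → VEFS1993_step24 → VEFS1993_eq412`, whence
  `VEFS1993_thm42_of_step2`.

What remains for `VEFS1993_thm42_holds`: `VEFS1993_step24` (Griffiths' comparison with the
`(d-1)`-dimensional `+` state, `m*_{d-1}(β) > 0` for `β > β_c(d-1)`) and `VEFS1993_step2` (FKG
monotonicity, infinite-volume limits, and the uniqueness theorem of Step 2.2).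
-/

noncomputable section

namespace Literature.Barriers.CriticalPhenomena.NonGibbs

open MeasureTheory Finset Filter Literature.Probability.LatticeModels

variable (d : ℕ)

/-! ### The decorated lattice of internal spins -/

/-- **The decorated lattice of internal spins** (van Enter–Fernández–Sokal Figure 3 (b): "The
decorated system of internal spins"; §4.1.2 Step 1: with ALL image spins — the origin included —
fixed in a fully alternating configuration, "each internal spin is adjacent either to two image
spins of opposite sign — in which case the effective magnetic fields cancel — or else to no image
spin. Therefore, the modified object system is simply a ferromagnetic Ising model in zero field
on a decorated lattice"; §4.3.1 p. 111: the system `⟨∞;Σ⟩` "is precisely the Ising model on a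
periodically diluted lattice"): the nearest-neighbour graph of `ℤ^d` restricted to the internal
sites (those with an odd coordinate, the sites of `gpiVolume'`); every image site `2x`, the origin
included, is isolated. [cite: VanenterFernandezSokal1993, §4.1.2 Step 1 (Figure 3 (b)) and §4.3.1 Step 2.4] -/
def decoratedGraph : SimpleGraph (Site d) where
  Adj x y := (zdGraph d).Adj x y ∧ (¬∀ i, (2 : ℤ) ∣ x i) ∧ ¬∀ i, (2 : ℤ) ∣ y i
  symm := ⟨fun _ _ h => ⟨h.1.symm, h.2.2, h.2.1⟩⟩
  loopless := ⟨fun x h => (zdGraph d).loopless.1 x h.1⟩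

/-- Adjacency in the decorated lattice is decidable (classically). [cite: VanenterFernandezSokal1993, §4.1.2 Step 1] -/
instance : DecidableRel (decoratedGraph d).Adj := fun _ _ => Classical.dec _

/-- The decorated lattice is locally finite (a subgraph of `ℤ^d`). [cite: VanenterFernandezSokal1993, §4.1.2 Step 1] -/
instance : (decoratedGraph d).LocallyFinite := fun x =>
  Fintype.ofFinset
    (open Classical in ((zdGraph d).neighborFinset x).filter fun y =>
      (¬∀ i, (2 : ℤ) ∣ x i) ∧ ¬∀ i, (2 : ℤ) ∣ y i)
    (by
      intro y
      simp only [Finset.mem_filter, SimpleGraph.mem_neighborFinset, SimpleGraph.mem_neighborSet]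
      rfl)

/-! ### The named facts: Steps 2.1–2.3 (phase selection) and Steps 1/2.4 (magnetisation) -/

/-- **van Enter–Fernández–Sokal 1993, §4.3.1 Step 1 with Step 2.4 — the `+` phase of the
internal-spin system for the alternating image configuration is magnetised at the neighbours of
the origin** ("the diluted system is a collection of `(d-1)`-dimensional diluted and undiluted
Ising models, ferromagnetically coupled. In particular, the `d`-dimensional diluted system is more
ferromagnetic than the `(d-1)`-dimensional undiluted Ising model, and hence exhibits spontaneous
magnetization for all temperatures below the critical temperature `J_{c,d-1}` of the
`(d-1)`-dimensional undiluted Ising model", Step 1, p. 107; "Step 2.4) Let `μ^{∞(+)}_Σ` be the `+`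
phase (i.e. the maximal Gibbs measure in FKG sense) for the system `⟨∞;Σ⟩`. Then
`μ^{∞(+)}_Σ(σ_i) ≥ c > 0`", p. 109, for the internal sites `i ∈ Λ^int_R` of (4.26); §4.2 Step 1:
"For the decimation example, `f` is the spin at a neighbor of the origin"; (4.12)–(4.13):
"`⟨σ_{0,1}⟩₊` is bounded below by a strictly positive constant, uniformly in `R`").
Transcription, in finite volume with `+` boundary condition on the internal spins (whose
one-point functions dominate those of the `+` phase): for `d ≥ 3` and `β > β_c(d-1)` there is
`c > 0` such that for every nearest neighbour `y` of the origin and every `L`, the zero-field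
Ising model on the decorated lattice `decoratedGraph d` in the volume `Λ^int_L = gpiVolume' d L`
with `+` boundary condition has `⟨σ_y⟩⁺ ≥ c`. Named fact, not proved here.
[cite: VanenterFernandezSokal1993, §4.3.1 Step 1 and Step 2.4, eq. (4.26)] -/
def VEFS1993_step24 : Prop :=
  ∀ d : ℕ, 3 ≤ d → ∀ β : ℝ, criticalBeta (d - 1) < β → ∃ c : ℝ, 0 < c ∧
    ∀ y : Site d, (zdGraph d).Adj 0 y →
      ∀ L : ℕ, c ≤ isingExpect (decoratedGraph d) (gpiVolume' d L) β 0 .plus (spinAt y)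

/-- **van Enter–Fernández–Sokal 1993, §4.3.1 Steps 2.1–2.3 — phase selection by the image spins
of the annulus, for the internal-spin system with the origin fixed** ("Step 2.1)
`μ^{Σ,+,σ}_{R,R'}` converges as `R' → ∞` to a Gibbs measure for the system `⟨R;∞;Σ;+⟩`. Step 2.2)
The system `⟨R;∞;Σ;+⟩` has a unique Gibbs measure, call it `μ^{Σ,+}_{R,∞}`. Step 2.3) The measure
`μ^{Σ,+}_{R,∞}` is larger (in FKG sense) than all Gibbs measures for the system `⟨∞;Σ⟩`", p. 109;
whence (4.26) "`⟨σ_i⟩^{R,R'}_{Σ,+,σ} ≥ ⟨σ_i⟩^{R,R'}_{Σ,+,-} ≥ c > 0`" and "by symmetry" (4.27);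
here `μ^{Σ,+,σ}_{R,R'}` is "the system of internal spins in volume `Λ^int_{R'}`, with the image
spins in `Λ^image_R` fixed in the alternating (`Σ`) configuration, the image spins in the annulus
`Λ^image_{R'} ∖ Λ^image_R` fixed to be all `+`, and the spins outside `Λ_{R'}` (both image and
internal) fixed in an arbitrary configuration `σ`", p. 108 — the origin being one of the image
spins of `Λ^image_R`, `ω'_alt(0) = +1` — and `⟨∞;Σ⟩`, "the image spins everywhere fixed in the
alternating (`Σ`) configuration", is "precisely the Ising model on a periodically diluted
lattice", p. 111; footnote 51: "`μ ≤ ν` in FKG sense in case `μ(f) ≤ ν(f)` for all increasing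
local observables `f`"). Transcription, entirely in finite volume, for the two internal-spin
systems of `VEFS1993_eq412`: the extremal system `⟨R,R';Σ,+,-⟩` of (4.26) (boundary condition
`coreAnnulusBC d 2 R R' 1 (-1)`: `ω'_alt` on the image sites of `Λ_R`, `+1` on those of the
annulus, `-1` at all other sites) and the global spin flip `-coreAnnulusBC d 2 R R' (-1) 1` of the
extremal system `⟨R,R';Σ,-,+⟩` of (4.27) (pattern `-ω'_alt` on `Λ_R`, `+1` on the annulus, `-1`
elsewhere; footnote 48): for `d ≥ 3`, `β > β_c(d-1)`, every increasing observable `f` depending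
only on finitely many internal spins, every `R` and `ε > 0`, there is `N` such that for all
`R', L ≥ N` the zero-field Ising expectation of `f` in the volume `Λ^int_{R'} = gpiVolume' d R'`
under either boundary condition is at least the expectation of `f` in the `+` state of the
decorated lattice `decoratedGraph d` (the finite-volume `+` states of `⟨∞;Σ⟩`, resp. `⟨∞;-Σ⟩`,
whose image fields cancel, and which dominate its `+` phase) in the volume `gpiVolume' d L`, up
to `ε`. Named fact, not proved here (printed proof: weak limits of Feller specifications;
uniqueness for `+` image spins, "at all temperatures", via Lee–Yang, Lebowitz–Penrose and
Lebowitz' inequality (4.29), or Pirogov–Sinai; FKG).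
[cite: VanenterFernandezSokal1993, §4.3.1 Steps 2.1–2.3, eqs. (4.26)–(4.27)] -/
def VEFS1993_step2 : Prop :=
  ∀ d : ℕ, 3 ≤ d → ∀ β : ℝ, criticalBeta (d - 1) < β →
    ∀ f : SpinConfig (Site d) → ℝ, Monotone f →
      ∀ D : Finset (Site d), (∀ y ∈ D, ¬∀ i, (2 : ℤ) ∣ y i) → DependsOn f (↑D : Set (Site d)) →
        ∀ R : ℕ, ∀ ε : ℝ, 0 < ε → ∃ N : ℕ, ∀ R' L : ℕ, N ≤ R' → N ≤ L →
          isingExpect (decoratedGraph d) (gpiVolume' d L) β 0 .plus f - ε ≤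
              isingExpect (zdGraph d) (gpiVolume' d R') β 0
                (.fixed (coreAnnulusBC d 2 R R' 1 (-1))) f ∧
            isingExpect (decoratedGraph d) (gpiVolume' d L) β 0 .plus f - ε ≤
              isingExpect (zdGraph d) (gpiVolume' d R') β 0
                (.fixed (-coreAnnulusBC d 2 R R' (-1) 1)) f

variable {d}

/-! ### Geometry: the neighbours of the origin are internal sites -/

/-- The neighbours of the origin in `ℤ^d` are the `± e_i`. [cite: FriedliVelenik2017, §3.1] -/
theorem zdGraph_adj_zero_iff (y : Site d) :
    (zdGraph d).Adj 0 y ↔ ∃ i, y = Pi.single i 1 ∨ y = -Pi.single i 1 := by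
  rw [zdGraph_adj_iff]
  refine exists_congr fun i => ?_
  rw [zero_add]
  constructor
  · rintro (h | h)
    · exact Or.inl h
    · exact Or.inr (eq_neg_of_add_eq_zero_left h.symm)
  · rintro (h | h)
    · exact Or.inl h
    · refine Or.inr ?_
      rw [h, neg_add_cancel]

/-- A neighbour of the origin is an internal site: one of its coordinates is `±1`.
[cite: VanenterFernandezSokal1993, §4.1.2 Step 3] -/
theorem not_forall_two_dvd_of_adj_zero {y : Site d} (hy : (zdGraph d).Adj 0 y) :
    ¬∀ i, (2 : ℤ) ∣ y i := by
  obtain ⟨i, h | h⟩ := (zdGraph_adj_zero_iff y).1 hy <;>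
  · intro hall
    have := hall i
    rw [h] at this
    simp only [Pi.neg_apply, Pi.single_eq_same] at this
    omega

/-- The neighbour spin sum of the origin is the spin total over its neighbour set.
[cite: VanenterFernandezSokal1993, eq. (4.7)] -/
theorem nbrSpinSum_eq_spinTotal (a : Site d) :
    nbrSpinSum (zdGraph d) a = spinTotal ((zdGraph d).neighborFinset a) := rfl

/-! ### The uniform gap (4.12) from Steps 2 and 2.4 -/

/-- **(4.12), proved: `VEFS1993_eq412` from phase selection (`VEFS1993_step2`) and the
magnetisation of the internal `+` phase (`VEFS1993_step24`).** With `S = ∑_{y∼0} σ_y`,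
`x = ⟨e^{-2βS}⟩` in the extremal system of (4.26) and `y = ⟨e^{+2βS}⟩` in the flipped extremal
system of (4.27): Step 2 applied to the increasing local observables `-e^{-2βS}` and `e^{+2βS}`
gives `x ≤ ⟨e^{-2βS}⟩⁺_{dec} + ε` and `y ≥ ⟨e^{2βS}⟩⁺_{dec} - ε` for `R'` large, in the `+` state
of the decorated lattice in the same volume; there, expanding
`e^{±2βS} = ∏_{y∼0}(cosh 2β ± σ_y sinh 2β)` into spin products, only odd products survive in the
difference, with nonnegative coefficients, so by Griffiths' first inequality
`⟨e^{2βS} - e^{-2βS}⟩⁺_{dec} ≥ 2 cosh^{2d-1}(2β) sinh(2β) ⟨σ_{e₁}⟩⁺_{dec} ≥ 2 cosh^{2d-1}(2β)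
sinh(2β) c` ((4.12) with Step 2.4); with `ε` a quarter of this, `y - x ≥ η := cosh^{2d-1}(2β)
sinh(2β) c > 0`, uniformly in `R` ((4.13)).
[cite: VanenterFernandezSokal1993, §4.1.2 Step 3, eqs. (4.12)–(4.13), and §4.3.1 Steps 2.4, 3] -/
theorem VEFS1993_eq412_of_step2 (h2 : VEFS1993_step2) (h24 : VEFS1993_step24) :
    VEFS1993_eq412 := by
  intro d hd β hβ
  have hβ0 : 0 < β := lt_of_le_of_lt (criticalBeta_nonneg (d - 1)) hβ
  obtain ⟨c, hc, hmag⟩ := h24 d hd β hβ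
  -- a neighbour of the origin
  have hd0 : 0 < d := by omega
  set y₀ : Site d := Pi.single ⟨0, hd0⟩ 1 with hy₀
  have hadj₀ : (zdGraph d).Adj 0 y₀ := (zdGraph_adj_zero_iff y₀).2 ⟨⟨0, hd0⟩, Or.inl rfl⟩
  -- the neighbour set of the origin and the two observables of (4.10)–(4.11)
  set N₀ : Finset (Site d) := (zdGraph d).neighborFinset 0 with hN₀
  have hy₀N : y₀ ∈ N₀ := (SimpleGraph.mem_neighborFinset _ _ _).2 hadj₀
  have hN₀int : ∀ y ∈ N₀, ¬∀ i, (2 : ℤ) ∣ y i := fun y hy =>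
    not_forall_two_dvd_of_adj_zero ((SimpleGraph.mem_neighborFinset _ _ _).1 hy)
  have hN₀sub : ∀ {L : ℕ}, 1 ≤ L → N₀ ⊆ gpiVolume' d L := fun hL y hy =>
    mem_gpiVolume'_of_adj_zero hL ((SimpleGraph.mem_neighborFinset _ _ _).1 hy)
  set g : SpinConfig (Site d) → ℝ :=
    fun σ => Real.exp (-(2 * β * nbrSpinSum (zdGraph d) 0 σ)) with hg
  set gt : SpinConfig (Site d) → ℝ :=
    fun σ => Real.exp (2 * β * nbrSpinSum (zdGraph d) 0 σ) with hgt
  have hgm : Measurable g :=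
    Real.measurable_exp.comp ((measurable_nbrSpinSum (zdGraph d) 0).const_mul _).neg
  have hgtm : Measurable gt :=
    Real.measurable_exp.comp ((measurable_nbrSpinSum (zdGraph d) 0).const_mul _)
  have hgt_mono : Monotone gt := fun σ τ h =>
    Real.exp_le_exp.2 (mul_le_mul_of_nonneg_left (nbrSpinSum_mono (zdGraph d) 0 h) (by positivity))
  have hng_mono : Monotone fun σ => -g σ := fun σ τ h => by
    simp only [hg, neg_le_neg_iff]
    exact Real.exp_le_exp.2 (by nlinarith [nbrSpinSum_mono (zdGraph d) 0 h, hβ0.le])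
  have hdepS : ∀ {σ τ : SpinConfig (Site d)}, (∀ x ∈ (↑N₀ : Set (Site d)), σ x = τ x) →
      nbrSpinSum (zdGraph d) 0 σ = nbrSpinSum (zdGraph d) 0 τ := fun h => by
    rw [nbrSpinSum_eq_spinTotal]
    exact spinTotal_congr N₀ fun x hx => h x (Finset.mem_coe.2 hx)
  have hdep_g : DependsOn (fun σ => -g σ) (↑N₀ : Set (Site d)) := fun σ τ h => by
    simp only [hg, hdepS h]
  have hdep_gt : DependsOn gt (↑N₀ : Set (Site d)) := fun σ τ h => by
    simp only [hgt, hdepS h]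
  -- the constants of (4.12)
  set K : ℝ := Real.cosh (2 * β) ^ (#N₀ - 1) * Real.sinh (2 * β) with hK
  have hKpos : 0 < K := mul_pos (pow_pos (Real.cosh_pos _) _) (Real.sinh_pos_iff.2 (by positivity))
  set κ : ℝ := K * c with hκ
  have hκpos : 0 < κ := mul_pos hKpos hc
  refine ⟨κ, hκpos, fun R => ?_⟩
  -- Step 2 for the two observables, with `ε = κ / 2`
  obtain ⟨N₁, hN₁⟩ := h2 d hd β hβ (fun σ => -g σ) hng_mono N₀ hN₀int hdep_g R (κ / 2)
    (half_pos hκpos)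
  obtain ⟨N₂, hN₂⟩ := h2 d hd β hβ gt hgt_mono N₀ hN₀int hdep_gt R (κ / 2) (half_pos hκpos)
  set R' : ℕ := max (max N₁ N₂) (R + 1) with hR'
  have hN₁R' : N₁ ≤ R' := (le_max_left _ _).trans (le_max_left _ _)
  have hN₂R' : N₂ ≤ R' := (le_max_right _ _).trans (le_max_left _ _)
  have hRR' : R < R' := lt_of_lt_of_le (Nat.lt_succ_self R) (le_max_right _ _)
  have hR'1 : 1 ≤ R' := le_trans (by omega) (le_max_right _ _)
  refine ⟨R', hRR', ?_⟩
  -- `x ≤ ⟨g⟩⁺_dec + κ/2` and `y ≥ ⟨gt⟩⁺_dec - κ/2`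
  have hx_le : isingExpect (zdGraph d) (gpiVolume' d R') β 0
      (.fixed (coreAnnulusBC d 2 R R' 1 (-1))) g ≤
      isingExpect (decoratedGraph d) (gpiVolume' d R') β 0 .plus g + κ / 2 := by
    have hneg : ∀ (G : SimpleGraph (Site d)) [DecidableRel G.Adj] [G.LocallyFinite]
        (Λ : Finset (Site d)) (bc : BoundaryCondition (Site d)),
        isingExpect G Λ β 0 bc (fun σ => -g σ) = -isingExpect G Λ β 0 bc g := by
      intro G _ _ Λ bc
      have := isingExpect_const_mul' G Λ 0 bc β (-1) hgm
      simpa using this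
    have h := (hN₁ R' R' hN₁R' hN₁R').1
    rw [hneg, hneg] at h
    linarith
  have hy_ge : isingExpect (decoratedGraph d) (gpiVolume' d R') β 0 .plus gt - κ / 2 ≤
      isingExpect (zdGraph d) (gpiVolume' d R') β 0 (.fixed (-coreAnnulusBC d 2 R R' (-1) 1)) gt :=
    (hN₂ R' R' hN₂R' hN₂R').2
  -- (4.12) in the decorated `+` state: `⟨gt - g⟩⁺ ≥ 2 K ⟨σ_{y₀}⟩⁺ ≥ 2 K c`
  have hgap_dec : 2 * κ ≤ isingExpect (decoratedGraph d) (gpiVolume' d R') β 0 .plus gt -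
      isingExpect (decoratedGraph d) (gpiVolume' d R') β 0 .plus g := by
    have hsub : isingExpect (decoratedGraph d) (gpiVolume' d R') β 0 .plus gt -
        isingExpect (decoratedGraph d) (gpiVolume' d R') β 0 .plus g =
        isingExpect (decoratedGraph d) (gpiVolume' d R') β 0 .plus (fun σ => gt σ - g σ) := by
      have hneg1 : isingExpect (decoratedGraph d) (gpiVolume' d R') β 0 .plus (fun σ => (-1) * g σ) =
          (-1) * isingExpect (decoratedGraph d) (gpiVolume' d R') β 0 .plus g :=
        isingExpect_const_mul' _ _ 0 .plus β (-1) hgm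
      have hadd := isingExpect_add' (decoratedGraph d) (gpiVolume' d R') 0 .plus β hgtm
        (hgm.const_mul (-1))
      have hfun : (fun σ => gt σ - g σ) = fun σ => gt σ + (-1) * g σ := by funext σ; ring
      rw [hfun, hadd, hneg1]
      ring
    rw [hsub]
    have hgks := isingExpect_exp_spinTotal_sub_ge (decoratedGraph d) (hN₀sub hR'1) hy₀N hβ0.le
      (by positivity : (0 : ℝ) ≤ 2 * β)
    have hmag₀ := hmag y₀ hadj₀ R'
    have hfun : (fun σ => Real.exp (2 * β * spinTotal N₀ σ) - Real.exp (-(2 * β) * spinTotal N₀ σ)) =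
        fun σ => gt σ - g σ := by
      funext σ
      simp only [hg, hgt, nbrSpinSum_eq_spinTotal, hN₀, neg_mul]
    rw [hfun] at hgks
    calc 2 * κ = 2 * K * c := by rw [hκ]; ring
      _ ≤ 2 * K * isingExpect (decoratedGraph d) (gpiVolume' d R') β 0 .plus (spinAt y₀) :=
          mul_le_mul_of_nonneg_left hmag₀ (by positivity)
      _ = 2 * Real.cosh (2 * β) ^ (#N₀ - 1) * Real.sinh (2 * β) *
            isingExpect (decoratedGraph d) (gpiVolume' d R') β 0 .plus (spinAt y₀) := by
          rw [hK]; ring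
      _ ≤ _ := hgks
  change κ ≤ isingExpect (zdGraph d) (gpiVolume' d R') β 0 (.fixed (-coreAnnulusBC d 2 R R' (-1) 1)) gt -
    isingExpect (zdGraph d) (gpiVolume' d R') β 0 (.fixed (coreAnnulusBC d 2 R R' 1 (-1))) g
  linarith

/-- **Theorem 4.2 from Steps 2 and 2.4** (through (4.12), Step 3, (4.32) and the conclusion of
the argument, all proved): what remains for `VEFS1993_thm42_holds` is `VEFS1993_step2` and
`VEFS1993_step24`. [cite: VanenterFernandezSokal1993, Theorem 4.2] -/
theorem VEFS1993_thm42_of_step2 (h2 : VEFS1993_step2) (h24 : VEFS1993_step24) : VEFS1993_thm42 :=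
  VEFS1993_thm42_of_eq412 (VEFS1993_eq412_of_step2 h2 h24)

/-- The barrier from Steps 2 and 2.4. [cite: VanenterFernandezSokal1993, Theorem 4.2] -/
theorem positionSpaceRGNonGibbsian_of_step2 (h2 : VEFS1993_step2) (h24 : VEFS1993_step24) :
    PositionSpaceRGNonGibbsian :=
  positionSpaceRGNonGibbsian_of_eq412 (VEFS1993_eq412_of_step2 h2 h24)

end Literature.Barriers.CriticalPhenomena.NonGibbs

end
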